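import Mathlib
import Literature.MathematicalPhysics.QuantumFieldTheory.Balaban1983to89.B11SectFAssembly
import Literature.MathematicalPhysics.QuantumFieldTheory.Balaban1983to89.B11Eq161HBChain

/-!
# `Balaban1983to89.B11SectFReg165Assembly` — T. Bałaban, *The variational problem and background fields in renormalization group
# method for lattice gauge theories*, Commun. Math. Phys. **102** (1985) 277–309 [Balaban1985Variational], **Sect. F, second case
# (pp. 300–304): the leaf `B11SectFAssembly.Leaves.reg165` — (152) ∧ (165) on Δ = □ — ASSEMBLED** over the Theorem-1 carrier from the
# finer located displays of the printed proof, the numeric chain (161) ⇒ (164) ⇒ (165) taken BY NAME from `B11Eq161HBChain`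

statement-level skeleton of published theorems with citation tags; proofs where landed; nothing here is a claim about the Yang–Mills mass gap

PDF held: `paper:balaban1985-cmp102-variational-background` (journal page = PDF page + 276); pp. 285–287 [PDF 9–11] ((45)–(47), (55),
(59)–(62)) and pp. 300–305 [PDF 24–29] ((144)–(169)) read by this seat from the `lit read` text.

CITATION HEADER (lean-in-tree rule 2026-08-18).  WHAT IS REPRODUCED: the field `reg165` of the located-leaf structure
`B11SectFAssembly.Leaves` (reader r08, p264246) — *"(152) ∧ (165) for Δ = □ (second case, M_Δ = M, M′ = M/(R₁M₁)): for U critical in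
𝔘_k(ε₀) ∩ 𝔅_k(V), V with (7), under the three displayed restrictions, the gauge u of (152) exists on □ (`Gauged`) and |A|, |∇^ηA|,
|∂^{η*}∂^ηA|, |Δ^ηA| < ¼M_Δmax{B₃ε₁, ½ε₀} + B₀(C₄ + 4C₂)(36dL²B₁R₁M₁)²(M′ε₀)² (165) on □"* — which feeds `B11SectFAssembly.regularity_of_leaves`
/ `sectFPrinted_of_leaves` / `thm1Printed_of_prop7_leaves`, DERIVED (its type verbatim, at L := the geometry's L and K := `K165`) from
the displayed statements the printed proof pp. 300–304 uses, each a hypothesis field of `ChainLeaves` read at per-cube data `ChainData`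
that the carrier `B11.VarProblemX` does not carry.  References of the paper used: [3] = [Balaban1984PropagatorsII] (multiscale distance,
the kernel bound of H), [5] = [Balaban1985BackgroundPropagators] (Thm 3.12, (46)), [6] = [Balaban1985RegularSpaces] (Theorem 2
(1.33)–(1.35) p. 82 = (152); Lemma 1 for (160)).

THE PRINT (pp. 301–304 [PDF 25–28], verbatim where quoted).  p. 301: *"Now we apply Theorem 2 of the paper [6] to the pair of configurations
U′_k, 1 … We assume that 9dL²Mε₀ ≦ c₁. Then there exists a unique gauge transformation u satisfying the restrictions ū_j = 1 on Λ′_j, and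
such that U′_k^{u⁻¹} = e^{iηA},  Lʲη|A|, (Lʲη)²|∇A|, (Lʲη)³|∂^{η*}∂^ηA|, (Lʲη)³|Δ^ηA| < 9dL²B₁Mε₀ on Ω′_j, j = 0, 1, …, k; (152)  R∂^{η*}A = 0,
(153)"*.  p. 302: *"K₁ = e^{iB} with |B| < 18d²L³Mε₀, (155) … we make the change of variables A = A′ − HD(A′). The configuration A′
satisfies (152) with 36 instead of 9 on the right-hand side. We have to assume that 36dL²B₁Mε₀ ≦ a₃ … The image of U′_k is a minimum of
𝔊(A′), thus representing it as A₁ + HB, we obtain Eq. (143) for A₁ … (158). The configurations HB and A₁ satisfy (152) with the bounds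
4dL²B₁Mε₀ and 40dL²B₁Mε₀ correspondingly. The image of U′_k translated by −HB satisfies Eq. (158). We assume that it belongs to the
domain on which this equation has a unique solution, i.e. we assume that 40dL²B₁Mε₀ ≦ a₄ … all the operators in this section are taken
without any external gauge field configuration"*.  p. 303: *"(9), (10) for a cube □ of a size 2M. In this case y is a center of □. We have
constructed the configuration U₁ = e^{iηA}, and A is given by A = A₁ + HB − HD(A₁ + HB), (159) where A₁ satisfies Eq. (158) … |B(x,x′)| <
(8d²L² + 4L²|x − y|)ε₁ for ⟨x,x′⟩ ∈ □′_k^{(k−1)} ∪ □″_k^{(k)}. (160) This bound and the global bound (152) imply the following bounds on the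
cube Δ(y₁), Δ(y₁) = Δ₀ or y₁ ∈ □, |HB|, |∇^ηHB|, |∂^{η*}∂^ηHB|, |Δ^ηHB| ≦ B₀Σ_{c∈ℭ_k}e^{−δ₀d(y₁,c₋)}(L^{j(c)}η)^{−1}|B(c)| < … (161) … where
y₁ ∈ Δ, and M_Δ = 1 for Δ = Δ₀, M_Δ = M for Δ = □ … B₃ = 72d³L³B₀ sup sup Σ … (162)"*.  p. 304: (163) *"B₃e^{−(1/2)δ₀R₁M₁} ≦ ½"*, (164), and
*"This bound, the equality (159) and Eq. (158) imply |A|, |∇^ηA|, |∂^{η*}∂^ηA|, |Δ^ηA| < ¼M_Δmax{B₃ε₁, ½ε₀} + B₀C₄(36dL²B₁Mε₀)² +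
B₀4C₂(36dL²B₁Mε₀)² ≦ ¼M_Δmax{B₃ε₁, ½ε₀} + B₀(C₄ + 4C₂)(36dL²B₁R₁M₁)²(M′ε₀)², (165) where … M′ = (R₁M₁)⁻¹M in the second case"*.
Sect. B/C inputs: (46) p. 285 *"|HB| ≦ B₀(Lʲη)⁻¹|B|, |∇HB| ≦ B₀(Lʲη)⁻²|B|"* ([5] Thm 3.12); (55) p. 286 *"|D(A′)| … ≦ 4C₂|A′|²_{(−1)}"*; Prop. 4
(98) p. 293; p. 306 *"the new operator G̃ has exactly the same properties as Δ_a⁻¹"* ((117): norm ≦ B₀).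

WHAT IS CERTIFIED (kernel, sorry-free; axioms `propext` / `Classical.choice` / `Quot.sound`).
§1 `ChainData` (DATA per cube □ not carried by `VarProblemX`: a seminormed group E □ of 𝔤-valued fields on □̃ with the scaled (152)-norm
   ‖·‖ = max{Lʲη sup|·|, (Lʲη)² sup|∇·|, (Lʲη)³ sup|∂*∂·|, (Lʲη)³ sup|Δ·|} over the Ω′_j, a seminormed group F □ of currents; the A of
   (152)/(159), A₁, HB; the operators H, D, G̃, W = (δ/δA)V₁ at the background 1; the three □-seminorms `pBox □ 0/1/2` = the same
   sup-norms restricted to □ grouped as in (9)/(10); over a `B6.Geometry` the finite sets ℭ_k(□) (148) with its near/far parts, the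
   observation sites of □, |B(c)| and |y₂ − y|), `K165` (= B₀(C₄ + 4C₂)(36dL²B₁R₁M₁)², the K of (165)–(166)), `K165_pos`,
   `ChainLeaves` (Prop: the located displays listed field by field in its docstring — (152)–(153) with the dictionary to the carrier's
   norm functionals, (157), (158), (46)/(117), (55), (98), (161)₁, (160), (155), (144)/(148), (162)–(163), side conditions).
§2 **`ineq164_box`** ((164) on □ for each □-seminorm, by `B11Eq161HBChain.ineq164_strict` at M_Δ = M — the printed case *"M_Δ = M for
   Δ = □"* —, ρ₁ = d²M), `eps0_pos` (ε₀ > 0 from (152)), **`ineq165_box`** ((165) on □: pBox A < ¼M·max{B₃ε₁, ½ε₀} + K165·(M/R₁M₁·ε₀)², by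
   `B11Eq161HBChain.ineq165` + `B11Smallness.ineq165_quadratic_terms`), **`reg165_of_chain`** — conclusion = THE TYPE OF THE FIELD
   `B11SectFAssembly.Leaves.reg165` at (d, L, K) := (d, g.L, K165) —, `leaves_of_chain` (a `Leaves` record from the chain and the four
   first-case / Hölder leaf fields `reg165_unit`, `dev1142`, `inU_local`, `holder136`, so that `B11SectFAssembly.sectFPrinted_of_leaves` /
   `thm1Printed_of_prop7_leaves` apply by name).
§3 (v1.1) the first-case twin on the CENTRAL unit cube Δ₀(□): `UnitData` (Δ₀-seminorms, sites of Δ₀), `UnitLeaves` (Δ₀ ⊂ □̃, Δ₀ ⊂ □, the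
   located separation d(y₁, y₂) ≥ M from Δ₀(□) to ℭ_k ∖ □_k, |y₁ − y| ≤ d², the Δ₀-dictionary of (152) for `CubeData`, (161)₁ on Δ₀),
   `ineq163_at_size`, **`ineq164_unit`** (`ineq164_strict` in its printed first case *"M = R₁M₁ ∧ M_Δ = 1"* read at R₁M₁ := M),
   **`ineq165_unit`**, **`reg165_unit_of_chain`** — conclusion = THE TYPE OF THE FIELD `Leaves.reg165_unit` —, `leaves_of_chain_unit`
   (a `Leaves` record with BOTH (165)-leaves derived; only `dev1142`, `inU_local`, `holder136` remain leaves).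
With this file the leaf (165)|_{Δ = □} of the kernel-assembled DAG of [Balaban1985Variational] is pushed down to its printed inputs: the
in-edges [6] Thm 2 ((152), cell node N05 [B8]) and the H-kernel bound (161)₁ ([3]/[5]), the lattice-level rows (160) (`B11Eq160BondField`),
(155) (`B11Eq155BlockLog`), and the Sect. B–E structural facts (157)–(159).

HONEST SCOPE — what is NOT proved here: every field of `ChainLeaves` / `UnitLeaves` (displayed statements of the paper or of [3], [5], [6]
read at the data, never asserted); in §2 the first-case twin `Leaves.reg165_unit` ((165) on Δ = Δ₀) stays a leaf of `leaves_of_chain` —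
its printed chain runs through `B11Eq161HBChain.line2_le_line3` in the case *"M = R₁M₁ ∧ M_Δ = 1"*, i.e. for the class cubes of size R₁M₁,
while the field is stated for every class cube; §3 derives it for every class cube from the same chain read at R₁M₁ := M, the one
extra located input being the separation d(y₁, y₂) ≥ M from the CENTRAL unit cube Δ₀(□) to ℭ_k ∖ □_k (= the printed (144) when M = R₁M₁;
a located reading, recorded as the hypothesis `UnitLeaves.sep_unit`, not a statement of the paper for M > R₁M₁); nothing of the lattice
(the objects of `ChainData` / `UnitData` are abstract).  No new named fact (`ChainLeaves`, `UnitLeaves` are hypothesis structures;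
`ChainData`, `UnitData` are data; `K165` a definition with body).  Seat prover `pub-ymgap-dag-n07-c` (R134 fan-out, N07 [B11] strategy
s1), cell pub-ymgap; imports `B11SectFAssembly`, `B11Eq161HBChain`; modifies nothing there.  Net new unproved facts: 0.
VERSIONS: v1 = p450655 (ACCEPTED 3aa235c89bc3, §1–§2); v1.1 (append-only, every v1 declaration byte-identical) adds §3.
-/

namespace Literature.MathematicalPhysics.QuantumFieldTheory.Balaban1983to89.B11SectFReg165Assembly

open Literature.MathematicalPhysics.QuantumFieldTheory.Balaban1983to89
open B11 B11SectFAssembly B11Eq161HBChain B11B3 B11Holder9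

/-! ## §1 Per-cube data and the located displays of pp. 300–304 -/

/-- **Per-cube analytic data of Sect. F not carried by the Theorem-1 carrier** `B11.VarProblemX` (which only NAMES `Gauged`, `normA`,
`normGradA`, `normLapA`): for every class cube □ a seminormed additive group `E □` (read: 𝔤-valued bond fields on the neighbourhood □̃ of
(144), normed by the scaled global norm of (152), ‖A‖ = max over the Ω′_j of Lʲη|A|, (Lʲη)²|∇^ηA|, (Lʲη)³|∂^{η*}∂^ηA|, (Lʲη)³|Δ^ηA|) and
`F □` (currents); the field `fldA U □` = the A of (152)/(159) (U′_k^{u⁻¹} = e^{iηA}, U′_k the axial-gauge transform of U centred at the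
centre y of □, u the gauge of [6] Thm 2 for the pair (U′_k, 1)), `fldA₁ U □` = A₁ and `fldHB U □` = HB of (158)–(159); the operators
`opH` = H ((45)–(46)), `opD` = D ((47)–(55)), `opGt` = G̃ ((143), p. 306), `opW` = (δ/δA)V₁ ((158)) — all *"without any external gauge
field configuration"* (p. 302); `pBox □ i`, i = 0, 1, 2: the additive-group seminorms Lʲη sup_□|·|, (Lʲη)² sup_□|∇^η·|,
(Lʲη)³ max{sup_□|∂^{η*}∂^η·|, sup_□|Δ^η·|} (the quantities of (9)/(10) on □ in the scaled units of (152)); over a multiscale geometry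
`g` ([3] Sect. 2, tree carrier `B6.Geometry`): `calC □` = ℭ_k of (148) with its near part `nearC □` = (Λ′_{k−1} ∪ Λ′_k) ∩ □_k and far part
`farC □` = ℭ_k ∖ □_k ((161)), `boxSites □` = the observation points y₁ ∈ □ of (161), `absB U □ y₂ μ` = |B(c)| for the cell
c = ⟨y₂, y₂ + L^{j₂}ηe_μ⟩ ((154)–(156), (160)), `rho □ y₂` = |y₂ − y| ((160)).  Data only; the located statements about them are
`ChainLeaves`. [cite: Balaban1985Variational, (144)–(161) pp.300–303] -/
structure ChainData (P : VarProblemX) (E F : P.Cube → Type) [∀ c, SeminormedAddCommGroup (E c)]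
    (g : B6.Geometry) (d : ℕ) where
  fldA : P.Cfg → (c : P.Cube) → E c
  fldA₁ : P.Cfg → (c : P.Cube) → E c
  fldHB : P.Cfg → (c : P.Cube) → E c
  opH : (c : P.Cube) → E c → E c
  opD : (c : P.Cube) → E c → E c
  opGt : (c : P.Cube) → F c → E c
  opW : (c : P.Cube) → E c → F c
  pBox : (c : P.Cube) → Fin 3 → AddGroupSeminorm (E c)
  calC : P.Cube → Finset g.Site
  nearC : P.Cube → Finset g.Site
  farC : P.Cube → Finset g.Site
  boxSites : P.Cube → Finset g.Site
  absB : P.Cfg → P.Cube → g.Site → Fin d → ℝ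
  rho : P.Cube → g.Site → ℝ

/-- **K of (165)–(166)**: K = B₀(C₄ + 4C₂)(36dL²B₁R₁M₁)², so that the second-order terms of (165) read B₀C₄(36dL²B₁Mε₀)² +
B₀4C₂(36dL²B₁Mε₀)² = K(M′ε₀)², M′ = M/(R₁M₁) (`B11Smallness.ineq165_quadratic_terms`); the `K` of `B11SectFAssembly.Leaves`/`a5`/`a1F`.
[cite: Balaban1985Variational, (165)–(166) p.304] -/
def K165 (d : ℕ) (L B₀ B₁ C₂ C₄ R₁M₁ : ℝ) : ℝ :=
  B₀ * (C₄ + 4 * C₂) * (36 * (d : ℝ) * L ^ 2 * B₁ * R₁M₁) ^ 2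

/-- K > 0 for positive constants (C₂, C₄ ≥ 0 with C₄ + 4C₂ > 0). [cite: Balaban1985Variational, (166) p.304] -/
theorem K165_pos {d : ℕ} {L B₀ B₁ C₂ C₄ R₁M₁ : ℝ} (hd : 1 ≤ d) (hL : 0 < L) (hB₀ : 0 < B₀) (hB₁ : 0 < B₁)
    (hC : 0 < C₄ + 4 * C₂) (hR : 0 < R₁M₁) : 0 < K165 d L B₀ B₁ C₂ C₄ R₁M₁ := by
  unfold K165
  have hd' : (0 : ℝ) < d := by exact_mod_cast hd
  positivity

/-- **The located displays of the printed proof of (152) ∧ (165) on □** (pp. 300–304 [PDF 24–28]) as hypotheses over the Theorem-1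
carrier and the data `X : ChainData`, field by field a displayed statement of the paper or of [3], [5], [6] read at these data —
NEVER asserted here.  Constants: δ₀ ([3] decay rate), B₀ ((46), (117)), B₁ ([6] Thm 2), B₃ ((162)), C₂ ((44), (55)), C₄ (Prop. 4 (98)),
S (the sup of (162), `B11B3.Claim162`-shape), R₁M₁ ((144)), c₁ ([6] Thm 2: *"We assume that 9dL²Mε₀ ≦ c₁"* p. 301), a₃ (p. 302
*"We have to assume that 36dL²B₁Mε₀ ≦ a₃"*), a₄ (p. 302 *"we assume that 40dL²B₁Mε₀ ≦ a₄"*).  M = `P.sizeM □`.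
* side conditions: d, L, R₁M₁ ≥ 1, η > 0 (both for `g` and for the carrier's `tinv`), δ₀ ≥ 0, B₀, B₁ > 0, C₂, C₄ ≥ 0, and p. 300
  *"In both cases M ≧ R₁M₁"* (`size_ge`); `pBox_le`: □ ⊂ □̃, the □-seminorms are dominated by the global norm.
* geometry: `calC_cover`/`near_far_disjoint` — ℭ_k = near ∪ far, disjointly ((161)); `calC_nonempty`; `dist_nonneg` ([3] (2.46));
  `absB_nonneg`; `sep144` — (144) *"dist(□_{n+1}, □_n^c) = R₁M₁Lⁿη"*: d(y₁, y₂) ≥ R₁M₁ for y₁ ∈ □ ⊂ □_k, y₂ ∉ □_k; `rho_nonneg`, `rho_le` —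
  the located triangle inequality |y₂ − y| ≤ d(y₁, y₂) + |y₁ − y| ([3] (2.48)) with |y₁ − y| ≤ d²M for y₁ ∈ □ (y the centre of □, □ of
  size 2M; `B11Eq161HBChain.line2_le_line3`, ρ₁ = d²M_Δ, M_Δ = M).
* `sum162_le`, `B₃_eq`, `ineq163` — (162) *"B₃ = 72d³L³B₀ sup_{ℭ_k} sup_{y₁} Σ…"* with the inner sum ≤ S at every y₁ ∈ □, and (163).
* `h46`, `hGt` — (46) ‖HX‖ ≤ B₀‖X‖ ([5] Thm 3.12) and ‖G̃f‖ ≤ B₀‖f‖ (p. 306, (117)); `h55` — (55) ‖D(Y)‖ ≤ 4C₂‖Y‖², `h98` — Prop. 4 (98)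
  ‖((δ/δA)V₁)(Y)‖ ≤ C₄‖Y‖², both on the domain ‖Y‖ ≤ a₃ of p. 302 (*"in order to have a well-defined functional 𝔊(A′)"*).
* `h152` — **[6] Theorem 2 at the pair (U′_k, 1)** ((150)–(153) p. 301): for U critical in 𝔘_k(ε₀) ∩ 𝔅_k(V) and 9dL²Mε₀ ≦ c₁ the gauge u
  exists (`Gauged U □`), the A of (152) has ‖A‖ < 9dL²B₁Mε₀, and the carrier's norm functionals of (9)–(10) on □ are (dominated by) the
  □-seminorms of this A in the units (Lʲη)^{−1}, (Lʲη)^{−2}, (Lʲη)^{−3} (`tinv`) — the dictionary *"there exists a gauge transformation u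
  defined on a neighborhood of □ and such that on □, U^{u⁻¹} = e^{iηA}"* (Thm 1 p. 279) ↔ (152).
* `h157` — **the Sect. B change of variables** (p. 302, (47), (59)–(62)): A = A′ − HD(A′) with A′ =: A₁ + HB and *"A′ satisfies (152)
  with 36 instead of 9"*, under 36dL²B₁Mε₀ ≦ a₃; together with A′ = A₁ + HB this is (159).
* `h158` — **(158)** (= (143) at the background 1, J = 0): A₁ = −G̃((δ/δA)V₁)(A₁ + HB), for U critical (*"The image of U′_k is a minimum
  of 𝔊(A′)"*), under 40dL²B₁Mε₀ ≦ a₄.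
* `h160` — **(160)** (from (7) for V, the axial gauge of V₁ centred at y, and Lemma 1 of [6]; *"and ε₁ small"*): |B(c)| < (8d²L² +
  4L²|y₂ − y|)ε₁ on the near cells; `h155` — **(155)** |B| < 18d²L³Mε₀ (on the far cells, where it is used in (161)).
* `h161` — **(161), first member** (the kernel bound of H at the background 1, [3]/[5]): each □-seminorm of HB is ≦ the kernel sum
  B₀Σ_{c∈ℭ_k}e^{−δ₀d(y₁,c₋)}(L^{j(c)}η)^{−1}|B(c)| at some observation point y₁ ∈ □ (the sup over the finite □ is attained).
[cite: Balaban1985Variational, Sect. F (144)–(163) pp.300–304; (46) p.285, (55) p.286, (98) p.293, (117) p.295] -/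
structure ChainLeaves (P : VarProblemX) {E F : P.Cube → Type} [∀ c, SeminormedAddCommGroup (E c)]
    [∀ c, SeminormedAddCommGroup (F c)] {g : B6.Geometry} {d : ℕ} (X : ChainData P E F g d)
    (δ₀ B₀ B₁ B₃ C₂ C₄ S R₁M₁ c₁ a₃ a₄ : ℝ) : Prop where
  one_le_d : 1 ≤ d
  one_le_L : 1 ≤ g.L
  eta_pos : 0 < g.eta
  PL_pos : 0 < P.L
  Peta_pos : 0 < P.eta
  δ₀_nonneg : 0 ≤ δ₀
  B₀_pos : 0 < B₀
  B₁_pos : 0 < B₁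
  C₂_nonneg : 0 ≤ C₂
  C₄_nonneg : 0 ≤ C₄
  one_le_R : 1 ≤ R₁M₁
  size_ge : ∀ c : P.Cube, R₁M₁ ≤ P.sizeM c
  pBox_le : ∀ (c : P.Cube) (i : Fin 3) (x : E c), X.pBox c i x ≤ ‖x‖
  calC_cover : ∀ (c : P.Cube) (y : g.Site), y ∈ X.calC c ↔ y ∈ X.nearC c ∨ y ∈ X.farC c
  near_far_disjoint : ∀ c : P.Cube, Disjoint (X.nearC c) (X.farC c)
  calC_nonempty : ∀ c : P.Cube, (X.calC c).Nonempty
  dist_nonneg : ∀ y₁ y₂ : g.Site, 0 ≤ g.dist y₁ y₂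
  absB_nonneg : ∀ (U : P.Cfg) (c : P.Cube) (y₂ : g.Site) (μ : Fin d), 0 ≤ X.absB U c y₂ μ
  sep144 : ∀ (c : P.Cube), ∀ y₁ ∈ X.boxSites c, ∀ y₂ ∈ X.farC c, R₁M₁ ≤ g.dist y₁ y₂
  rho_nonneg : ∀ (c : P.Cube), ∀ y₂ ∈ X.nearC c, 0 ≤ X.rho c y₂
  rho_le : ∀ (c : P.Cube), ∀ y₁ ∈ X.boxSites c, ∀ y₂ ∈ X.nearC c, X.rho c y₂ ≤ g.dist y₁ y₂ + (d : ℝ) ^ 2 * P.sizeM c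
  sum162_le : ∀ (c : P.Cube), ∀ y₁ ∈ X.boxSites c, sum162 g δ₀ (X.calC c) y₁ ≤ S
  B₃_eq : B₃ = 72 * (d : ℝ) ^ 3 * g.L ^ 3 * B₀ * S
  ineq163 : B₃ * Real.exp (-(δ₀ / 2 * R₁M₁)) ≤ 1 / 2
  h46 : ∀ (c : P.Cube) (x : E c), ‖X.opH c x‖ ≤ B₀ * ‖x‖
  hGt : ∀ (c : P.Cube) (f : F c), ‖X.opGt c f‖ ≤ B₀ * ‖f‖
  h55 : ∀ (c : P.Cube) (Y : E c), ‖Y‖ ≤ a₃ → ‖X.opD c Y‖ ≤ 4 * C₂ * ‖Y‖ ^ 2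
  h98 : ∀ (c : P.Cube) (Y : E c), ‖Y‖ ≤ a₃ → ‖X.opW c Y‖ ≤ C₄ * ‖Y‖ ^ 2
  h152 : ∀ (ε₀ : ℝ) (V : P.Bdry) (U : P.Cfg) (c : P.Cube), P.InU ε₀ U → P.InB V U → P.IsCritical V U →
    9 * (d : ℝ) * g.L ^ 2 * P.sizeM c * ε₀ ≤ c₁ →
    P.Gauged U c ∧ ‖X.fldA U c‖ < 9 * (d : ℝ) * g.L ^ 2 * B₁ * P.sizeM c * ε₀ ∧
    P.normA U c ≤ X.pBox c 0 (X.fldA U c) * tinv P c ^ 1 ∧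
    P.normGradA U c ≤ X.pBox c 1 (X.fldA U c) * tinv P c ^ 2 ∧
    P.normLapA U c ≤ X.pBox c 2 (X.fldA U c) * tinv P c ^ 3
  h157 : ∀ (ε₀ : ℝ) (U : P.Cfg) (c : P.Cube), P.Gauged U c →
    ‖X.fldA U c‖ < 9 * (d : ℝ) * g.L ^ 2 * B₁ * P.sizeM c * ε₀ → 36 * (d : ℝ) * g.L ^ 2 * B₁ * P.sizeM c * ε₀ ≤ a₃ →
    X.fldA U c = X.fldA₁ U c + X.fldHB U c - X.opH c (X.opD c (X.fldA₁ U c + X.fldHB U c)) ∧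
    ‖X.fldA₁ U c + X.fldHB U c‖ < 36 * (d : ℝ) * g.L ^ 2 * B₁ * P.sizeM c * ε₀
  h158 : ∀ (ε₀ : ℝ) (V : P.Bdry) (U : P.Cfg) (c : P.Cube), P.InU ε₀ U → P.InB V U → P.IsCritical V U →
    P.Gauged U c → ‖X.fldA₁ U c + X.fldHB U c‖ < 36 * (d : ℝ) * g.L ^ 2 * B₁ * P.sizeM c * ε₀ →
    40 * (d : ℝ) * g.L ^ 2 * B₁ * P.sizeM c * ε₀ ≤ a₄ →
    X.fldA₁ U c = -X.opGt c (X.opW c (X.fldA₁ U c + X.fldHB U c))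
  h160 : ∀ (ε₀ ε₁ : ℝ) (V : P.Bdry) (U : P.Cfg) (c : P.Cube), 0 < ε₁ → P.Reg7 ε₁ V → P.InU ε₀ U → P.InB V U →
    P.IsCritical V U → 9 * (d : ℝ) * g.L ^ 2 * P.sizeM c * ε₀ ≤ c₁ →
    ∀ y₂ ∈ X.nearC c, ∀ μ : Fin d, X.absB U c y₂ μ < (8 * (d : ℝ) ^ 2 * g.L ^ 2 + 4 * g.L ^ 2 * X.rho c y₂) * ε₁
  h155 : ∀ (ε₀ : ℝ) (V : P.Bdry) (U : P.Cfg) (c : P.Cube), P.InU ε₀ U → P.InB V U → P.IsCritical V U →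
    9 * (d : ℝ) * g.L ^ 2 * P.sizeM c * ε₀ ≤ c₁ →
    ∀ y₂ ∈ X.farC c, ∀ μ : Fin d, X.absB U c y₂ μ < 18 * (d : ℝ) ^ 2 * g.L ^ 3 * P.sizeM c * ε₀
  h161 : ∀ (U : P.Cfg) (c : P.Cube) (i : Fin 3), P.Gauged U c →
    ∃ y₁ ∈ X.boxSites c, X.pBox c i (X.fldHB U c) ≤ kernelSum g d δ₀ B₀ (X.calC c) (X.absB U c) y₁

/-! ## §2 The assembly: (161)₁ ⇒ (164) ⇒ (165) on □, and the leaf `reg165` -/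

section Assembly

variable {P : VarProblemX} {E F : P.Cube → Type} [∀ c, SeminormedAddCommGroup (E c)]
  [∀ c, SeminormedAddCommGroup (F c)] {g : B6.Geometry} {d : ℕ} {X : ChainData P E F g d}
  {δ₀ B₀ B₁ B₃ C₂ C₄ S R₁M₁ c₁ a₃ a₄ : ℝ}

/-- ε₀ > 0 behind (152): the strict bound ‖A‖ < 9dL²B₁Mε₀ with ‖A‖ ≥ 0 and d, L, B₁, M > 0.
[cite: Balaban1985Variational, (152) p.301] -/
theorem eps0_pos (hX : ChainLeaves P X δ₀ B₀ B₁ B₃ C₂ C₄ S R₁M₁ c₁ a₃ a₄) {ε₀ : ℝ} {U : P.Cfg} {c : P.Cube}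
    (hA : ‖X.fldA U c‖ < 9 * (d : ℝ) * g.L ^ 2 * B₁ * P.sizeM c * ε₀) : 0 < ε₀ := by
  have hd : (1 : ℝ) ≤ d := by exact_mod_cast hX.one_le_d
  have hM : 1 ≤ P.sizeM c := le_trans hX.one_le_R (hX.size_ge c)
  have hpos : 0 < 9 * (d : ℝ) * g.L ^ 2 * B₁ * P.sizeM c * ε₀ := lt_of_le_of_lt (norm_nonneg _) hA
  have hcoef : 0 < 9 * (d : ℝ) * g.L ^ 2 * B₁ * P.sizeM c := by
    have := hX.B₁_pos; have := hX.one_le_L; positivity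
  by_contra h
  have h' : ε₀ ≤ 0 := not_lt.mp h
  have : 9 * (d : ℝ) * g.L ^ 2 * B₁ * P.sizeM c * ε₀ ≤ 0 := mul_nonpos_of_nonneg_of_nonpos hcoef.le h'
  linarith

/-- **(164) on □** (p. 304 [PDF 28], verbatim: *"Then we get on Δ |HB|, |∇^ηHB|, |∂^{η*}∂^ηHB|, |Δ^ηHB| < ¼M_Δmax{B₃ε₁, ½ε₀}. (164)"*, here
Δ = □, M_Δ = M): each □-seminorm of HB is < ¼M·max{B₃ε₁, ½ε₀}, from the first member of (161) (`h161`) through the printed chain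
(161)₁ < (161)₂ ≦ … ≦ (161)₅ ≦ ¼M_Δmax{B₃ε₁, ½ε₀} — `B11Eq161HBChain.ineq164_strict` in the case *"M_Δ = M for Δ = □"* with (160), (155),
(144), the located triangle inequality (ρ₁ = d²M), (162) and (163). [cite: Balaban1985Variational, (161)–(164) pp.303–304] -/
theorem ineq164_box (hX : ChainLeaves P X δ₀ B₀ B₁ B₃ C₂ C₄ S R₁M₁ c₁ a₃ a₄) {ε₀ ε₁ : ℝ} {V : P.Bdry} {U : P.Cfg}
    {c : P.Cube} (hε₁ : 0 < ε₁) (hV : P.Reg7 ε₁ V) (hU : P.InU ε₀ U) (hB : P.InB V U) (hcrit : P.IsCritical V U)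
    (hr1 : 9 * (d : ℝ) * g.L ^ 2 * P.sizeM c * ε₀ ≤ c₁) (hε₀ : 0 ≤ ε₀) (hG : P.Gauged U c) (i : Fin 3) :
    X.pBox c i (X.fldHB U c) < 1 / 4 * P.sizeM c * max (B₃ * ε₁) (ε₀ / 2) := by
  classical
  obtain ⟨y₁, hy₁, hQ⟩ := hX.h161 U c i hG
  have hC : X.nearC c ∪ X.farC c = X.calC c := by
    ext y
    rw [Finset.mem_union, hX.calC_cover]
  have hM : 1 ≤ P.sizeM c := le_trans hX.one_le_R (hX.size_ge c)
  exact ineq164_strict (M := P.sizeM c) (MΔ := P.sizeM c) (ρ₁ := (d : ℝ) ^ 2 * P.sizeM c) hQ hX.B₀_pos hX.δ₀_nonneg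
    hX.one_le_d hX.one_le_L hX.eta_pos hε₁.le hε₀ hM hC (hX.near_far_disjoint c) (hX.calC_nonempty c)
    (fun y₂ _ => hX.dist_nonneg y₁ y₂) (hX.absB_nonneg U c) (hX.h160 ε₀ ε₁ V U c hε₁ hV hU hB hcrit hr1)
    (hX.h155 ε₀ V U c hU hB hcrit hr1) (hX.sep144 c y₁ hy₁) (hX.rho_nonneg c) (hX.rho_le c y₁ hy₁) le_rfl
    (Or.inr rfl) (hX.sum162_le c y₁ hy₁) hX.B₃_eq hX.ineq163

/-- **(165) on □** (p. 304 [PDF 28]): for U critical in 𝔘_k(ε₀) ∩ 𝔅_k(V), V with (7), under the three displayed restrictions, each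
□-seminorm of the A of (159) is < ¼M·max{B₃ε₁, ½ε₀} + K·(M/R₁M₁·ε₀)², K = `K165` — (164) on □ (`ineq164_box`), (159) and (158) with the
norms of G̃, H and the quadratic bounds (98), (55) at A′ = A₁ + HB, ‖A′‖ < 36dL²B₁Mε₀ (`B11Eq161HBChain.ineq165`), and the rewriting of
the second-order terms (`B11Smallness.ineq165_quadratic_terms`, M′ = M/R₁M₁). [cite: Balaban1985Variational, (165) p.304] -/
theorem ineq165_box (hX : ChainLeaves P X δ₀ B₀ B₁ B₃ C₂ C₄ S R₁M₁ c₁ a₃ a₄) {ε₀ ε₁ : ℝ} {V : P.Bdry} {U : P.Cfg}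
    {c : P.Cube} (hε₁ : 0 < ε₁) (hV : P.Reg7 ε₁ V) (hU : P.InU ε₀ U) (hB : P.InB V U) (hcrit : P.IsCritical V U)
    (hr1 : 9 * (d : ℝ) * g.L ^ 2 * P.sizeM c * ε₀ ≤ c₁) (hr2 : 36 * (d : ℝ) * g.L ^ 2 * B₁ * P.sizeM c * ε₀ ≤ a₃)
    (hr3 : 40 * (d : ℝ) * g.L ^ 2 * B₁ * P.sizeM c * ε₀ ≤ a₄) (i : Fin 3) :
    P.Gauged U c ∧
    X.pBox c i (X.fldA U c) <
      1 / 4 * P.sizeM c * max (B₃ * ε₁) (ε₀ / 2) + K165 d g.L B₀ B₁ C₂ C₄ R₁M₁ * (P.sizeM c / R₁M₁ * ε₀) ^ 2 := by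
  obtain ⟨hG, hA9, -, -, -⟩ := hX.h152 ε₀ V U c hU hB hcrit hr1
  obtain ⟨h159, hA'⟩ := hX.h157 ε₀ U c hG hA9 hr2
  have h158 := hX.h158 ε₀ V U c hU hB hcrit hG hA' hr3
  have hε₀ : 0 < ε₀ := eps0_pos hX hA9
  have ha₃ : ‖X.fldA₁ U c + X.fldHB U c‖ ≤ a₃ := hA'.le.trans hr2
  have h164 := ineq164_box hX hε₁ hV hU hB hcrit hr1 hε₀.le hG i
  have h165 := ineq165 (X.pBox c i) (hX.pBox_le c i) hX.B₀_pos.le hX.C₂_nonneg hX.C₄_nonneg (hX.hGt c) (hX.h46 c)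
    h159 h158 (hX.h98 c _ ha₃) (hX.h55 c _ ha₃) hA'.le h164
  have hR : R₁M₁ ≠ 0 := by have := hX.one_le_R; positivity
  have hq := B11Smallness.ineq165_quadratic_terms (d : ℝ) g.L B₀ B₁ C₂ C₄ (P.sizeM c) (P.sizeM c / R₁M₁) R₁M₁ ε₀
    (by field_simp)
  refine ⟨hG, ?_⟩
  unfold K165
  linarith

/-- **The leaf `reg165` from the chain** — the conclusion is VERBATIM the type of the field `B11SectFAssembly.Leaves.reg165` ((152) ∧ (165)
for Δ = □: *"|A|, |∇^ηA|, |∂^{η*}∂^ηA|, |Δ^ηA| < ¼M_Δmax{B₃ε₁, ½ε₀} + B₀(C₄ + 4C₂)(36dL²B₁R₁M₁)²(M′ε₀)²"* on □ together with the gauge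
(152), for U critical in 𝔘_k(ε₀) ∩ 𝔅_k(V), V with (7), under the three displayed restrictions) at d := d, L := `g.L`, K := `K165`: by
`ineq165_box` for the three □-seminorms and the dictionary of `h152` (the carrier's norm functionals on □ ≤ □-seminorm × (Lʲη)^{−n},
n = 1, 2, 3). [cite: Balaban1985Variational, (152) p.301 + (165) p.304 + Thm 1 (9)–(10) p.279] -/
theorem reg165_of_chain (hX : ChainLeaves P X δ₀ B₀ B₁ B₃ C₂ C₄ S R₁M₁ c₁ a₃ a₄) :
    ∀ (ε₀ ε₁ : ℝ) (V : P.Bdry) (U : P.Cfg) (c : P.Cube), 0 < ε₁ → P.Reg7 ε₁ V → P.InU ε₀ U → P.InB V U →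
    P.IsCritical V U → 9 * (d : ℝ) * g.L ^ 2 * P.sizeM c * ε₀ ≤ c₁ → 36 * (d : ℝ) * g.L ^ 2 * B₁ * P.sizeM c * ε₀ ≤ a₃ →
    40 * (d : ℝ) * g.L ^ 2 * B₁ * P.sizeM c * ε₀ ≤ a₄ →
    P.Gauged U c ∧
    P.normA U c < (1 / 4 * P.sizeM c * max (B₃ * ε₁) (ε₀ / 2) +
      K165 d g.L B₀ B₁ C₂ C₄ R₁M₁ * (P.sizeM c / R₁M₁ * ε₀) ^ 2) * tinv P c ^ 1 ∧
    P.normGradA U c < (1 / 4 * P.sizeM c * max (B₃ * ε₁) (ε₀ / 2) +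
      K165 d g.L B₀ B₁ C₂ C₄ R₁M₁ * (P.sizeM c / R₁M₁ * ε₀) ^ 2) * tinv P c ^ 2 ∧
    P.normLapA U c < (1 / 4 * P.sizeM c * max (B₃ * ε₁) (ε₀ / 2) +
      K165 d g.L B₀ B₁ C₂ C₄ R₁M₁ * (P.sizeM c / R₁M₁ * ε₀) ^ 2) * tinv P c ^ 3 := by
  intro ε₀ ε₁ V U c hε₁ hV hU hB hcrit hr1 hr2 hr3
  obtain ⟨hG, -, hnA, hnG, hnL⟩ := hX.h152 ε₀ V U c hU hB hcrit hr1
  have h165 := fun i : Fin 3 => (ineq165_box hX hε₁ hV hU hB hcrit hr1 hr2 hr3 i).2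
  have ht : 0 < tinv P c := by
    unfold tinv
    exact inv_pos.mpr (mul_pos (pow_pos hX.PL_pos _) hX.Peta_pos)
  refine ⟨hG, ?_, ?_, ?_⟩
  · exact lt_of_le_of_lt hnA (mul_lt_mul_of_pos_right (h165 0) (pow_pos ht 1))
  · exact lt_of_le_of_lt hnG (mul_lt_mul_of_pos_right (h165 1) (pow_pos ht 2))
  · exact lt_of_le_of_lt hnL (mul_lt_mul_of_pos_right (h165 2) (pow_pos ht 3))

/-- **`B11SectFAssembly.Leaves` from the chain**: with the leaf `reg165` DERIVED (`reg165_of_chain`), a `Leaves` record over the carrier is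
assembled from the chain and the four remaining located leaves of `B11SectFAssembly` — the first-case displays `reg165_unit` ((165) on
Δ₀; NOT derived here, see the module header), `dev1142` ([6] (1.141)–(1.142)), `inU_local` (locality of (2)) and the Hölder companion
`holder136` ([6] Thm 2 (1.36)) —, so that `B11SectFAssembly.prop8Printed_of_leaves` / `sectFPrinted_of_leaves` / `thm1Printed_of_prop7_leaves`
apply by name with (d, L, K) := (d, g.L, `K165`). [cite: Balaban1985Variational, Sect. F pp.300–305] -/
theorem leaves_of_chain (hX : ChainLeaves P X δ₀ B₀ B₁ B₃ C₂ C₄ S R₁M₁ c₁ a₃ a₄) (D : CubeData P) {B₂ : ℝ}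
    (reg165_unit : ∀ (ε₀ ε₁ : ℝ) (V : P.Bdry) (U : P.Cfg) (c : P.Cube), 0 < ε₁ → P.Reg7 ε₁ V → P.InU ε₀ U → P.InB V U →
      P.IsCritical V U → 9 * (d : ℝ) * g.L ^ 2 * P.sizeM c * ε₀ ≤ c₁ → 36 * (d : ℝ) * g.L ^ 2 * B₁ * P.sizeM c * ε₀ ≤ a₃ →
      40 * (d : ℝ) * g.L ^ 2 * B₁ * P.sizeM c * ε₀ ≤ a₄ →
      D.normA0 U c < (1 / 4 * max (B₃ * ε₁) (ε₀ / 2) +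
        K165 d g.L B₀ B₁ C₂ C₄ R₁M₁ * (P.sizeM c / R₁M₁ * ε₀) ^ 2) * tinv P c ^ 1 ∧
      D.normGradA0 U c < (1 / 4 * max (B₃ * ε₁) (ε₀ / 2) +
        K165 d g.L B₀ B₁ C₂ C₄ R₁M₁ * (P.sizeM c / R₁M₁ * ε₀) ^ 2) * tinv P c ^ 2 ∧
      D.normLapA0 U c < (1 / 4 * max (B₃ * ε₁) (ε₀ / 2) +
        K165 d g.L B₀ B₁ C₂ C₄ R₁M₁ * (P.sizeM c / R₁M₁ * ε₀) ^ 2) * tinv P c ^ 3)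
    (dev1142 : ∀ (U : P.Cfg) (c : P.Cube) (e : ℝ), P.Gauged U c → 0 < e → e ≤ 1 →
      D.normA0 U c < e * tinv P c ^ 1 → D.normGradA0 U c < e * tinv P c ^ 2 → D.normLapA0 U c < e * tinv P c ^ 3 →
      D.plaqDev U c < 2 * e + 8 * e ^ 2 ∧ D.dstarDev U c < e + 36 * (d : ℝ) * e ^ 2 + 50 * (d : ℝ) * e ^ 3)
    (inU_local : ∀ (r : ℝ) (U : P.Cfg), 0 < r →
      (∀ c : P.Cube, P.sizeM c = R₁M₁ → D.plaqDev U c < r ∧ D.dstarDev U c < r) → P.InU r U)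
    (holder136 : ∀ (ε₀ ε₁ : ℝ) (V : P.Bdry) (U : P.Cfg) (c : P.Cube), 0 < ε₁ → P.Reg7 ε₁ V → P.InU ε₀ U → P.InB V U →
      P.IsCritical V U → 9 * (d : ℝ) * g.L ^ 2 * P.sizeM c * ε₀ ≤ c₁ →
      HolderClause (P.holderA U c) 1 (B₂ * (ε₀ + (9 * (d : ℝ) * g.L ^ 2 * P.sizeM c * ε₀ - ε₀))) (tinv P c)) :
    Leaves P D (d : ℝ) g.L B₁ B₂ B₃ (K165 d g.L B₀ B₁ C₂ C₄ R₁M₁) R₁M₁ c₁ a₃ a₄ where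
  L_pos := hX.PL_pos
  eta_pos := hX.Peta_pos
  size_ge := hX.size_ge
  reg165 := reg165_of_chain hX
  reg165_unit := reg165_unit
  dev1142 := dev1142
  inU_local := inU_local
  holder136 := holder136

end Assembly

/-! ## §3 (v1.1, append-only) The first-case twin on the central unit cube Δ₀(□): the leaf `reg165_unit` from the same chain

p. 303 [PDF 27]: *"the following bounds on the cube Δ(y₁), Δ(y₁) = Δ₀ or y₁ ∈ □ … where y₁ ∈ Δ, and M_Δ = 1 for Δ = Δ₀"*; p. 304: (164),
(165), (167) *"on Δ"*.  The print runs the first case for Δ₀ ⊂ □ with □ *"a cube of the size R₁M₁ containing Δ₀"* (M′ = 1); the leaf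
`B11SectFAssembly.Leaves.reg165_unit` (and `CubeData`) read Δ₀ = Δ₀(□) as the CENTRAL unit cube of an arbitrary class cube □ (size M ≥ R₁M₁,
centre y = the point defining Δ₀).  For that reading the printed chain goes through unchanged with R₁M₁ replaced by M in its two
geometric inputs — the separation d(y₁, y₂) ≥ M for y₁ ∈ Δ₀(□), y₂ ∈ ℭ_k ∖ □_k (from (144) dist(□, □_k^c) = R₁M₁ ≥ 1, dist(Δ₀(□), □^c) ≥
M − 1, and [3] (2.48) multiscale distance ≥ lattice distance) and (163) at M ≥ R₁M₁ (monotonicity of e^{−½δ₀M}) —, i.e.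
`B11Eq161HBChain.ineq164_strict` in its printed first case *"M = R₁M₁ ∧ M_Δ = 1"* read at R₁M₁ := M. -/

/-- **Per-cube data of the first case** beside `X : ChainData` and `D : CubeData`: the three Δ₀(□)-seminorms `pUnit □ i`, i = 0, 1, 2
(Lʲη sup_{Δ₀}|·|, (Lʲη)² sup_{Δ₀}|∇^η·|, (Lʲη)³ max{sup_{Δ₀}|∂^{η*}∂^η·|, sup_{Δ₀}|Δ^η·|} on the central unit cube Δ₀(□) ⊂ □, in the scaled
units of (152)) and the observation points `unitSites □` = the sites y₁ ∈ Δ₀(□) of (161).  Data only.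
[cite: Balaban1985Variational, (161) p.303 «Δ(y₁) = Δ₀», (165)–(167) p.304] -/
structure UnitData (P : VarProblemX) (E : P.Cube → Type) [∀ c, SeminormedAddCommGroup (E c)] (g : B6.Geometry) where
  pUnit : (c : P.Cube) → Fin 3 → AddGroupSeminorm (E c)
  unitSites : P.Cube → Finset g.Site

/-- **The located displays of the first case on Δ₀(□)** (pp. 302–304) beyond `ChainLeaves`, as hypotheses — NEVER asserted here:
`pUnit_le` (Δ₀ ⊂ □̃: the Δ₀-seminorms are dominated by the global norm); `unit_sub_box` (Δ₀(□) ⊂ □: its sites are observation points of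
□, so (162) applies); `sep_unit` — the located separation d(y₁, y₂) ≥ M for y₁ ∈ Δ₀(□) and the far cells y₂ ∈ ℭ_k ∖ □_k ((144) + Δ₀
central, see the §3 header; for M = R₁M₁ it is the printed use of (144)); `rho_le_unit` — |y₂ − y| ≤ d(y₁, y₂) + d² for y₁ ∈ Δ₀ = the unit
cube at y ([3] (2.48); `B11Eq161HBChain.line2_le_line3` with ρ₁ = d²M_Δ, M_Δ = 1); `h152_unit` — the dictionary of (152) for the
first-case data: under the hypotheses of [6] Thm 2 the three Δ₀-norm functionals of `D : CubeData` (p. 302 *"for plaquettes and bonds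
belonging to Δ₀"*) are (dominated by) the Δ₀-seminorms of the A of (152)/(159) in the units (Lʲη)^{−n}; `h161_unit` — (161), first
member, on Δ = Δ₀: each Δ₀-seminorm of HB is ≦ the kernel sum at some y₁ ∈ Δ₀ (sup attained).
[cite: Balaban1985Variational, (144) p.300, (152) p.301, (161) p.303, p.302 «we take a unit cube Δ₀»] -/
structure UnitLeaves (P : VarProblemX) {E F : P.Cube → Type} [∀ c, SeminormedAddCommGroup (E c)] {g : B6.Geometry} {d : ℕ}
    (X : ChainData P E F g d) (D : CubeData P) (Y : UnitData P E g) (δ₀ B₀ c₁ : ℝ) : Prop where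
  pUnit_le : ∀ (c : P.Cube) (i : Fin 3) (x : E c), Y.pUnit c i x ≤ ‖x‖
  unit_sub_box : ∀ c : P.Cube, Y.unitSites c ⊆ X.boxSites c
  sep_unit : ∀ (c : P.Cube), ∀ y₁ ∈ Y.unitSites c, ∀ y₂ ∈ X.farC c, P.sizeM c ≤ g.dist y₁ y₂
  rho_le_unit : ∀ (c : P.Cube), ∀ y₁ ∈ Y.unitSites c, ∀ y₂ ∈ X.nearC c, X.rho c y₂ ≤ g.dist y₁ y₂ + (d : ℝ) ^ 2
  h152_unit : ∀ (ε₀ : ℝ) (V : P.Bdry) (U : P.Cfg) (c : P.Cube), P.InU ε₀ U → P.InB V U → P.IsCritical V U →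
    9 * (d : ℝ) * g.L ^ 2 * P.sizeM c * ε₀ ≤ c₁ →
    D.normA0 U c ≤ Y.pUnit c 0 (X.fldA U c) * tinv P c ^ 1 ∧
    D.normGradA0 U c ≤ Y.pUnit c 1 (X.fldA U c) * tinv P c ^ 2 ∧
    D.normLapA0 U c ≤ Y.pUnit c 2 (X.fldA U c) * tinv P c ^ 3
  h161_unit : ∀ (U : P.Cfg) (c : P.Cube) (i : Fin 3), P.Gauged U c →
    ∃ y₁ ∈ Y.unitSites c, Y.pUnit c i (X.fldHB U c) ≤ kernelSum g d δ₀ B₀ (X.calC c) (X.absB U c) y₁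

section UnitAssembly

variable {P : VarProblemX} {E F : P.Cube → Type} [∀ c, SeminormedAddCommGroup (E c)]
  [∀ c, SeminormedAddCommGroup (F c)] {g : B6.Geometry} {d : ℕ} {X : ChainData P E F g d} {D : CubeData P}
  {Y : UnitData P E g} {δ₀ B₀ B₁ B₃ C₂ C₄ S R₁M₁ c₁ a₃ a₄ : ℝ}

/-- **(163) at a class cube**: B₃e^{−½δ₀M} ≦ ½ for M ≧ R₁M₁, from (163) *"B₃e^{−(1/2)δ₀R₁M₁} ≦ ½"* and δ₀ ≥ 0 (if B₃ < 0 there is nothing to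
prove). [cite: Balaban1985Variational, (163) p.304] -/
theorem ineq163_at_size (hX : ChainLeaves P X δ₀ B₀ B₁ B₃ C₂ C₄ S R₁M₁ c₁ a₃ a₄) (c : P.Cube) :
    B₃ * Real.exp (-(δ₀ / 2 * P.sizeM c)) ≤ 1 / 2 := by
  rcases le_or_gt 0 B₃ with hB₃ | hB₃
  · have hexp : Real.exp (-(δ₀ / 2 * P.sizeM c)) ≤ Real.exp (-(δ₀ / 2 * R₁M₁)) := by
      rw [Real.exp_le_exp]
      have := hX.δ₀_nonneg
      nlinarith [hX.size_ge c]
    exact (mul_le_mul_of_nonneg_left hexp hB₃).trans hX.ineq163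
  · have hpos := mul_pos (neg_pos.mpr hB₃) (Real.exp_pos (-(δ₀ / 2 * P.sizeM c)))
    nlinarith

/-- **(164) on Δ₀(□)** (p. 304, M_Δ = 1): each Δ₀-seminorm of HB is < ¼·max{B₃ε₁, ½ε₀} — `B11Eq161HBChain.ineq164_strict` in the printed
first case *"M = R₁M₁ ∧ M_Δ = 1"* read at R₁M₁ := M (the located separation `sep_unit`, ρ₁ = d², (163) at M by `ineq163_at_size`), with
(160), (155), (162). [cite: Balaban1985Variational, (161)–(164) pp.303–304] -/
theorem ineq164_unit (hX : ChainLeaves P X δ₀ B₀ B₁ B₃ C₂ C₄ S R₁M₁ c₁ a₃ a₄) (hY : UnitLeaves P X D Y δ₀ B₀ c₁)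
    {ε₀ ε₁ : ℝ} {V : P.Bdry} {U : P.Cfg} {c : P.Cube} (hε₁ : 0 < ε₁) (hV : P.Reg7 ε₁ V) (hU : P.InU ε₀ U)
    (hB : P.InB V U) (hcrit : P.IsCritical V U) (hr1 : 9 * (d : ℝ) * g.L ^ 2 * P.sizeM c * ε₀ ≤ c₁) (hε₀ : 0 ≤ ε₀)
    (hG : P.Gauged U c) (i : Fin 3) :
    Y.pUnit c i (X.fldHB U c) < 1 / 4 * 1 * max (B₃ * ε₁) (ε₀ / 2) := by
  classical
  obtain ⟨y₁, hy₁, hQ⟩ := hY.h161_unit U c i hG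
  have hy₁' : y₁ ∈ X.boxSites c := hY.unit_sub_box c hy₁
  have hC : X.nearC c ∪ X.farC c = X.calC c := by
    ext y
    rw [Finset.mem_union, hX.calC_cover]
  exact ineq164_strict (M := P.sizeM c) (MΔ := 1) (R₁M₁ := P.sizeM c) (ρ₁ := (d : ℝ) ^ 2) hQ hX.B₀_pos hX.δ₀_nonneg
    hX.one_le_d hX.one_le_L hX.eta_pos hε₁.le hε₀ le_rfl hC (hX.near_far_disjoint c) (hX.calC_nonempty c)
    (fun y₂ _ => hX.dist_nonneg y₁ y₂) (hX.absB_nonneg U c) (hX.h160 ε₀ ε₁ V U c hε₁ hV hU hB hcrit hr1)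
    (hX.h155 ε₀ V U c hU hB hcrit hr1) (hY.sep_unit c y₁ hy₁) (hX.rho_nonneg c) (hY.rho_le_unit c y₁ hy₁)
    (by rw [mul_one]) (Or.inl ⟨rfl, rfl⟩) (hX.sum162_le c y₁ hy₁') hX.B₃_eq (ineq163_at_size hX c)

/-- **(165) on Δ₀(□)** (p. 304, M_Δ = 1): under the hypotheses of `reg165_unit` each Δ₀-seminorm of the A of (159) is < ¼·max{B₃ε₁, ½ε₀} +
K·(M/R₁M₁·ε₀)², K = `K165` — (164) on Δ₀ (`ineq164_unit`), (159), (158), (98), (55), the norms of G̃ and H (`B11Eq161HBChain.ineq165`) and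
`B11Smallness.ineq165_quadratic_terms`. [cite: Balaban1985Variational, (165) p.304] -/
theorem ineq165_unit (hX : ChainLeaves P X δ₀ B₀ B₁ B₃ C₂ C₄ S R₁M₁ c₁ a₃ a₄) (hY : UnitLeaves P X D Y δ₀ B₀ c₁)
    {ε₀ ε₁ : ℝ} {V : P.Bdry} {U : P.Cfg} {c : P.Cube} (hε₁ : 0 < ε₁) (hV : P.Reg7 ε₁ V) (hU : P.InU ε₀ U)
    (hB : P.InB V U) (hcrit : P.IsCritical V U) (hr1 : 9 * (d : ℝ) * g.L ^ 2 * P.sizeM c * ε₀ ≤ c₁)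
    (hr2 : 36 * (d : ℝ) * g.L ^ 2 * B₁ * P.sizeM c * ε₀ ≤ a₃) (hr3 : 40 * (d : ℝ) * g.L ^ 2 * B₁ * P.sizeM c * ε₀ ≤ a₄)
    (i : Fin 3) :
    Y.pUnit c i (X.fldA U c) <
      1 / 4 * max (B₃ * ε₁) (ε₀ / 2) + K165 d g.L B₀ B₁ C₂ C₄ R₁M₁ * (P.sizeM c / R₁M₁ * ε₀) ^ 2 := by
  obtain ⟨hG, hA9, -, -, -⟩ := hX.h152 ε₀ V U c hU hB hcrit hr1
  obtain ⟨h159, hA'⟩ := hX.h157 ε₀ U c hG hA9 hr2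
  have h158 := hX.h158 ε₀ V U c hU hB hcrit hG hA' hr3
  have hε₀ : 0 < ε₀ := eps0_pos hX hA9
  have ha₃ : ‖X.fldA₁ U c + X.fldHB U c‖ ≤ a₃ := hA'.le.trans hr2
  have h164 := ineq164_unit hX hY hε₁ hV hU hB hcrit hr1 hε₀.le hG i
  have h165 := ineq165 (Y.pUnit c i) (hY.pUnit_le c i) hX.B₀_pos.le hX.C₂_nonneg hX.C₄_nonneg (hX.hGt c) (hX.h46 c)
    h159 h158 (hX.h98 c _ ha₃) (hX.h55 c _ ha₃) hA'.le h164
  have hR : R₁M₁ ≠ 0 := by have := hX.one_le_R; positivity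
  have hq := B11Smallness.ineq165_quadratic_terms (d : ℝ) g.L B₀ B₁ C₂ C₄ (P.sizeM c) (P.sizeM c / R₁M₁) R₁M₁ ε₀
    (by field_simp)
  unfold K165
  linarith

/-- **The leaf `reg165_unit` from the chain** — the conclusion is VERBATIM the type of the field `B11SectFAssembly.Leaves.reg165_unit` ((165)
for Δ = Δ₀(□), M_Δ = 1: the three Δ₀-norm functionals of `CubeData` are < (¼max{B₃ε₁, ½ε₀} + K(M′ε₀)²)(Lʲη)^{−n}, n = 1, 2, 3, for U
critical in 𝔘_k(ε₀) ∩ 𝔅_k(V), V with (7), under the three displayed restrictions) at (d, L, K) := (d, g.L, `K165`): by `ineq165_unit`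
and the dictionary `h152_unit`. [cite: Balaban1985Variational, (165)–(167) p.304 «on Δ»] -/
theorem reg165_unit_of_chain (hX : ChainLeaves P X δ₀ B₀ B₁ B₃ C₂ C₄ S R₁M₁ c₁ a₃ a₄) (hY : UnitLeaves P X D Y δ₀ B₀ c₁) :
    ∀ (ε₀ ε₁ : ℝ) (V : P.Bdry) (U : P.Cfg) (c : P.Cube), 0 < ε₁ → P.Reg7 ε₁ V → P.InU ε₀ U → P.InB V U →
    P.IsCritical V U → 9 * (d : ℝ) * g.L ^ 2 * P.sizeM c * ε₀ ≤ c₁ → 36 * (d : ℝ) * g.L ^ 2 * B₁ * P.sizeM c * ε₀ ≤ a₃ →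
    40 * (d : ℝ) * g.L ^ 2 * B₁ * P.sizeM c * ε₀ ≤ a₄ →
    D.normA0 U c < (1 / 4 * max (B₃ * ε₁) (ε₀ / 2) +
      K165 d g.L B₀ B₁ C₂ C₄ R₁M₁ * (P.sizeM c / R₁M₁ * ε₀) ^ 2) * tinv P c ^ 1 ∧
    D.normGradA0 U c < (1 / 4 * max (B₃ * ε₁) (ε₀ / 2) +
      K165 d g.L B₀ B₁ C₂ C₄ R₁M₁ * (P.sizeM c / R₁M₁ * ε₀) ^ 2) * tinv P c ^ 2 ∧
    D.normLapA0 U c < (1 / 4 * max (B₃ * ε₁) (ε₀ / 2) +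
      K165 d g.L B₀ B₁ C₂ C₄ R₁M₁ * (P.sizeM c / R₁M₁ * ε₀) ^ 2) * tinv P c ^ 3 := by
  intro ε₀ ε₁ V U c hε₁ hV hU hB hcrit hr1 hr2 hr3
  obtain ⟨hnA, hnG, hnL⟩ := hY.h152_unit ε₀ V U c hU hB hcrit hr1
  have h165 := fun i : Fin 3 => ineq165_unit hX hY hε₁ hV hU hB hcrit hr1 hr2 hr3 i
  have ht : 0 < tinv P c := by
    unfold tinv
    exact inv_pos.mpr (mul_pos (pow_pos hX.PL_pos _) hX.Peta_pos)
  refine ⟨?_, ?_, ?_⟩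
  · exact lt_of_le_of_lt hnA (mul_lt_mul_of_pos_right (h165 0) (pow_pos ht 1))
  · exact lt_of_le_of_lt hnG (mul_lt_mul_of_pos_right (h165 1) (pow_pos ht 2))
  · exact lt_of_le_of_lt hnL (mul_lt_mul_of_pos_right (h165 2) (pow_pos ht 3))

/-- **`B11SectFAssembly.Leaves` from the two chains**: with BOTH (165)-leaves DERIVED (`reg165_of_chain` on □, `reg165_unit_of_chain` on
Δ₀(□)), a `Leaves` record is assembled from the chain displays and the three remaining located leaves of `B11SectFAssembly` — `dev1142`
([6] (1.141)–(1.142) at the background 1), `inU_local` (locality and gauge invariance of (2)) and `holder136` ([6] Thm 2 (1.36)) —, so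
that `B11SectFAssembly.prop8Printed_of_leaves` / `sectFPrinted_of_leaves` / `thm1Printed_of_prop7_leaves` apply by name with (d, L, K) :=
(d, g.L, `K165`): Theorem 1 ⇐ Prop. 7 ∧ {(152) [6] Thm 2, (157)–(159), (161)₁, (160), (155), (144)/(148), (162)–(163), (1.36),
(1.141)–(1.142), locality of (2)}. [cite: Balaban1985Variational, Sect. F pp.300–305 + Thm 1 p.279] -/
theorem leaves_of_chain_unit (hX : ChainLeaves P X δ₀ B₀ B₁ B₃ C₂ C₄ S R₁M₁ c₁ a₃ a₄) (hY : UnitLeaves P X D Y δ₀ B₀ c₁)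
    {B₂ : ℝ}
    (dev1142 : ∀ (U : P.Cfg) (c : P.Cube) (e : ℝ), P.Gauged U c → 0 < e → e ≤ 1 →
      D.normA0 U c < e * tinv P c ^ 1 → D.normGradA0 U c < e * tinv P c ^ 2 → D.normLapA0 U c < e * tinv P c ^ 3 →
      D.plaqDev U c < 2 * e + 8 * e ^ 2 ∧ D.dstarDev U c < e + 36 * (d : ℝ) * e ^ 2 + 50 * (d : ℝ) * e ^ 3)
    (inU_local : ∀ (r : ℝ) (U : P.Cfg), 0 < r →
      (∀ c : P.Cube, P.sizeM c = R₁M₁ → D.plaqDev U c < r ∧ D.dstarDev U c < r) → P.InU r U)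
    (holder136 : ∀ (ε₀ ε₁ : ℝ) (V : P.Bdry) (U : P.Cfg) (c : P.Cube), 0 < ε₁ → P.Reg7 ε₁ V → P.InU ε₀ U → P.InB V U →
      P.IsCritical V U → 9 * (d : ℝ) * g.L ^ 2 * P.sizeM c * ε₀ ≤ c₁ →
      HolderClause (P.holderA U c) 1 (B₂ * (ε₀ + (9 * (d : ℝ) * g.L ^ 2 * P.sizeM c * ε₀ - ε₀))) (tinv P c)) :
    Leaves P D (d : ℝ) g.L B₁ B₂ B₃ (K165 d g.L B₀ B₁ C₂ C₄ R₁M₁) R₁M₁ c₁ a₃ a₄ :=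
  leaves_of_chain hX D (reg165_unit_of_chain hX hY) dev1142 inU_local holder136

end UnitAssembly

end Literature.MathematicalPhysics.QuantumFieldTheory.Balaban1983to89.B11SectFReg165Assembly
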